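import Literature.Probability.RandomPlanarGeometry.RectFrontierLoop
import Literature.Probability.RandomPlanarGeometry.ConformalMapRiemannProofs
import Literature.Probability.RandomPlanarGeometry.ConformalMapCaratheodoryProofs
import Literature.Probability.RandomPlanarGeometry.ConformalMapProofs
import Literature.Probability.RandomPlanarGeometry.JordanDomainProofs
import Literature.Probability.RandomPlanarGeometry.ImageUnivalent
import Literature.Probability.RandomPlanarGeometry.DiscRectangles
import Literature.Probability.RandomPlanarGeometry.PlanarDomainsTopology
import Literature.Probability.RandomPlanarGeometry.ChordalCurveFamily
import HarnessLib

/-!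
# Tame level rectangles: smoothing Schramm–Smirnov's perturbed quads by Riemann-map level curves

Topic `Literature/Probability/RandomPlanarGeometry`.  Schramm and Smirnov (Ann. Probab. 39 (2011),
§5, proof of Lemma 5.1) compare the crossing event of a quad with those of the perturbed quads
`Q̂₀([x₀, x₁] × [y₀, y₁])`, images of rectangles under a plane homeomorphism (the tree's square
models, `Percolation/QuadCrossingSquareModel`).  To get perturbed quads with a REGULAR boundary
loop (`C²`, nowhere-vanishing derivative) one replaces `F(Q)`, `Q = (-a, a) × (-b, b)`, by a level
rectangle of a Riemann map `g : 𝔻 → F(Q)`: the image of the disc `|z| < r`, `r` close to `1`,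
marked at the preimages under the Carathéodory extension of `g` of the four lateral points
`F(∓a, ∓h)`; by uniform continuity of the extension on the closed disc its boundary is, read in
the chart `F⁻¹`, `η`-close to `∂Q` arc by arc (Pommerenke 1992, Thm. 2.6: the level curves
`g(|z| = r)` are analytic Jordan curves converging to the boundary).

* `contDiff_levelLoop` — the loop `t ↦ g(r e^{i(2πt+θ)})` of a conformal disc map is `C²` with
  nowhere-vanishing derivative (`ConformalEquiv.deriv_ne_zero_holds`).
* `exists_levelRectangle_of_data` — bookkeeping: the marked image rectangle (`MarkedDomain.image`
  of `JordanDomain.rotUnitDisc θ` marked at `0 < t₁ < u < v`) and its seven properties, from an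
  embedding of the closed disc and a boundary correspondence positioned as in
  `RectLoop.arcs_position`.
* `exists_tame_levelRectangle` — **the result**: for `F : ℂ ≃ₜ ℂ`, `0 < a`, `0 < h < b`, `η > 0`
  there is a conformal rectangle `R'` with `C²`-regular boundary loop such that
  `closure R' ⊆ F(Q)`; `F p ∈ R'` whenever `|re p| ≤ a - η`, `|im p| ≤ b - η`; the points of
  `R'.arc 0` / `R'.arc 2` are `η`-close in the chart to points of `∂Q` of height `≤ -h` / `≥ h`;
  and the frontier points off `R'.arc 0` / off `R'.arc 2` are `η`-close to points of `∂Q` of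
  height `≥ -h` / `≤ h` (Riemann mapping theorem `exists_conformalEquiv_ball_holds`, Carathéodory
  `JordanDomain.exists_continuousOn_extension_holds`, `JordanDomain.isSimplyConnected_holds`).

Design: the orientation of the boundary correspondence is not controlled (the chart may reverse
it); the loop is started at whichever lower lateral point makes the arc to the other one run along
the bottom (`RectLoop.forall_Ioo_im_lt_or`).  Not here: the percolation clauses of the brackets of
a conformal rectangle in its square model (summit side).

## References

* O. Schramm, S. Smirnov, Ann. Probab. 39 (2011) 1768–1814, §5, proof of Lemma 5.1.
  [SchrammSmirnov2011]
* Ch. Pommerenke, *Boundary Behaviour of Conformal Maps* (1992), Thm. 2.6. [PommerenkeBBCM1992]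
-/

noncomputable section

open Set Filter Topology Complex Metric Real

namespace Literature.Probability.RandomPlanarGeometry

/-! ### Level loops of a disc map are tame -/

/-- **Level curves of a conformal disc map are regular analytic loops**: for a conformal
equivalence `g` of the unit disc onto some `V` and `0 < r < 1`, the loop
`t ↦ g (r e^{i(2πt + θ)})` is `C²` with nowhere-vanishing derivative (`g' ≠ 0`,
`ConformalEquiv.deriv_ne_zero_holds`). Pommerenke (1992), §2 (level curves `f({|z| = r})` are
analytic Jordan curves). [cite: PommerenkeBBCM1992, Thm. 2.6] -/
theorem contDiff_levelLoop {V : Set ℂ} (g : ConformalEquiv (ball (0 : ℂ) 1) V) {r : ℝ}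
    (hr0 : 0 < r) (hr1 : r < 1) (θ : ℝ) :
    ContDiff ℝ 2 (fun t : ℝ => g (circleMap 0 r (2 * π * t + θ))) ∧
      ∀ t : ℝ, deriv (fun t : ℝ => g (circleMap 0 r (2 * π * t + θ))) t ≠ 0 := by
  have hmem : ∀ s : ℝ, circleMap 0 r s ∈ ball (0 : ℂ) 1 := fun s => by
    rw [mem_ball_zero_iff, norm_circleMap_zero, abs_of_pos hr0]; exact hr1
  have hlin : ∀ t : ℝ, HasDerivAt (fun s : ℝ => 2 * π * s + θ) (2 * π) t := fun t => by
    simpa using ((hasDerivAt_id t).const_mul (2 * π)).add_const θ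
  have haff : ContDiff ℝ 2 (fun s : ℝ => 2 * π * s + θ) := by fun_prop
  refine ⟨?_, fun t => ?_⟩
  · rw [contDiff_iff_contDiffAt]
    intro t
    have hg : ContDiffAt ℝ 2 g (circleMap 0 r (2 * π * t + θ)) :=
      ((g.differentiableOn.analyticAt (isOpen_ball.mem_nhds (hmem _))).contDiffAt).restrict_scalars ℝ
    exact hg.comp t ((contDiff_circleMap 0 r).comp haff).contDiffAt
  · have hG : HasDerivAt g (deriv g (circleMap 0 r (2 * π * t + θ))) (circleMap 0 r (2 * π * t + θ)) :=
      ((g.differentiableOn _ (hmem _)).differentiableAt (isOpen_ball.mem_nhds (hmem _))).hasDerivAt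
    have hinner : HasDerivAt (circleMap 0 r ∘ fun s : ℝ => 2 * π * s + θ)
        ((2 * π) • (circleMap 0 r (2 * π * t + θ) * I)) t :=
      (hasDerivAt_circleMap 0 r (2 * π * t + θ)).scomp t (hlin t)
    have hcomp := hG.comp t hinner
    rw [show (fun t : ℝ => g (circleMap 0 r (2 * π * t + θ))) =
        (g : ℂ → ℂ) ∘ (circleMap 0 r ∘ fun s : ℝ => 2 * π * s + θ) from rfl, hcomp.deriv]
    refine mul_ne_zero (ConformalEquiv.deriv_ne_zero_holds g isOpen_ball (hmem _))
      (smul_ne_zero (by positivity) (mul_ne_zero (circleMap_ne_center hr0.ne') I_ne_zero))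

/-! ### The bracket from analytic data -/

/-- **Assembly of a tame rectangle from a disc embedding and a boundary correspondence.**
Given the chart `F`, the rectangle `Q = (-a, a) × (-b, b)`, a height `0 < h < b`, a tolerance `η`,
an embedding `gr` of the closed unit disc with `C²`-regular boundary loop from the phase `θ` and
`gr(closed disc) ⊆ F(Q) `, `F(η-deep points of Q) ⊆ gr(open disc)`, and a loop `Ψ` on `∂Q`,
`η`-close in the chart to that boundary loop, starting at a lateral point of height `-h` and
passing the other one at `t₁` after running below `-h`: the image rectangle marked at the four
lateral points of height `∓h` is tame and its arcs / frontier pieces are `η`-close in the chart to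
the corresponding sides of `Q`. [cite: SchrammSmirnov2011, §5 (proof of Lemma 5.1)] -/
theorem exists_levelRectangle_of_data (F : ℂ ≃ₜ ℂ) {a b h η : ℝ} (ha : 0 < a) (hh : 0 < h)
    (hhb : h < b) {gr : ℂ → ℂ} (hgrc : ContinuousOn gr (closedBall 0 1))
    (hgri : InjOn gr (closedBall 0 1)) {θ : ℝ}
    (htame : ContDiff ℝ 2 (fun t : ℝ => gr (circleMap 0 1 (2 * π * t + θ))) ∧
      ∀ t : ℝ, deriv (fun t : ℝ => gr (circleMap 0 1 (2 * π * t + θ))) t ≠ 0)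
    {Ψ : ℝ → ℂ} (hΨc : Continuous Ψ) (hΨ1 : Ψ 1 = Ψ 0) (hΨi : InjOn Ψ (Ico 0 1))
    (hΨr : Ψ '' Ico 0 1 = frontier (symRect a b)) (h0 : (Ψ 0).im = -h) {t₁ : ℝ}
    (ht₁ : t₁ ∈ Ioo (0 : ℝ) 1) (h1 : (Ψ t₁).im = -h) (hor : ∀ t ∈ Ioo 0 t₁, (Ψ t).im < -h)
    (hclose : ∀ t : ℝ, dist (F.symm (gr (circleMap 0 1 (2 * π * t + θ)))) (Ψ t) < η)
    (hsub : ∀ z ∈ closedBall (0 : ℂ) 1, gr z ∈ F '' symRect a b)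
    (hdeep : ∀ p : ℂ, |p.re| ≤ a - η → |p.im| ≤ b - η → F p ∈ gr '' ball 0 1) :
    ∃ R' : ConformalRectangle,
      (ContDiff ℝ 2 R'.boundary ∧ ∀ t : ℝ, deriv R'.boundary t ≠ 0) ∧
      closure R'.carrier ⊆ F '' symRect a b ∧
      (∀ p : ℂ, |p.re| ≤ a - η → |p.im| ≤ b - η → F p ∈ R'.carrier) ∧
      (∀ z ∈ R'.arc 0, ∃ q ∈ frontier (symRect a b), q.im ≤ -h ∧ dist (F.symm z) q < η) ∧
      (∀ z ∈ R'.arc 2, ∃ q ∈ frontier (symRect a b), h ≤ q.im ∧ dist (F.symm z) q < η) ∧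
      (∀ z ∈ frontier R'.carrier,
        z ∈ R'.arc 0 ∨ ∃ q ∈ frontier (symRect a b), -h ≤ q.im ∧ dist (F.symm z) q < η) ∧
      (∀ z ∈ frontier R'.carrier,
        z ∈ R'.arc 2 ∨ ∃ q ∈ frontier (symRect a b), q.im ≤ h ∧ dist (F.symm z) q < η) := by
  have hb : 0 < b := hh.trans hhb
  -- parameters of the two lateral points of height `h`
  have hP₂ : (⟨a, h⟩ : ℂ) ∈ frontier (symRect a b) :=
    (mem_frontier_symRect ha hb).2 (Or.inr ⟨Or.inr rfl, by simp; constructor <;> linarith⟩)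
  have hP₃ : (⟨-a, h⟩ : ℂ) ∈ frontier (symRect a b) :=
    (mem_frontier_symRect ha hb).2 (Or.inr ⟨Or.inl rfl, by simp; constructor <;> linarith⟩)
  obtain ⟨s₂, hs₂, e₂⟩ := RectLoop.exists_param hΨr hP₂
  obtain ⟨s₃, hs₃, e₃⟩ := RectLoop.exists_param hΨr hP₃
  have hs₂i : (Ψ s₂).im = h := by rw [e₂]
  have hs₃i : (Ψ s₃).im = h := by rw [e₃]
  have hs₂t : t₁ < s₂ := RectLoop.lt_of_im_eq hh h0 h1 hor hs₂ hs₂i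
  have hs₃t : t₁ < s₃ := RectLoop.lt_of_im_eq hh h0 h1 hor hs₃ hs₃i
  have hne : s₂ ≠ s₃ := by
    rintro rfl
    have := congrArg Complex.re (e₂.symm.trans e₃)
    simp at this; linarith
  obtain ⟨u, v, hu, huv, hv, hui, hvi⟩ :
      ∃ u v : ℝ, t₁ < u ∧ u < v ∧ v < 1 ∧ (Ψ u).im = h ∧ (Ψ v).im = h := by
    rcases lt_or_gt_of_ne hne with hlt | hlt
    · exact ⟨s₂, s₃, hs₂t, hlt, hs₃.2, hs₂i, hs₃i⟩
    · exact ⟨s₃, s₂, hs₃t, hlt, hs₂.2, hs₃i, hs₂i⟩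
  obtain ⟨P1, P2, P3, P4, P5⟩ :=
    RectLoop.arcs_position ha hh hhb hΨc hΨ1 hΨi hΨr h0 ht₁ h1 hor hu huv hv hui hvi
  have hu0 : 0 < u := ht₁.1.trans hu
  -- the marked disc and its image
  let D₀ : ConformalRectangle :=
    { toJordanDomain := JordanDomain.rotUnitDisc θ
      mark := ![0, t₁, u, v]
      strictMono_mark := by
        refine Fin.strictMono_iff_lt_succ.2 fun k => ?_
        fin_cases k <;> simp [ht₁.1, hu, huv]
      mark_mem := fun k => by
        fin_cases k
        · simp
        · simpa using ⟨ht₁.1.le, ht₁.2⟩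
        · simpa using ⟨hu0.le, huv.trans hv⟩
        · simpa using ⟨(hu0.trans huv).le, hv⟩ }
  have hcl : closure D₀.carrier = closedBall (0 : ℂ) 1 := closure_ball 0 one_ne_zero
  have hgrc' : ContinuousOn gr (closure D₀.carrier) := by rw [hcl]; exact hgrc
  have hgri' : InjOn gr (closure D₀.carrier) := by rw [hcl]; exact hgri
  have hbd : ∀ t : ℝ, D₀.boundary t = circleMap 0 1 (2 * π * t + θ) := fun t => rfl
  have hm0 : D₀.mark 0 = 0 := rfl
  have hm1 : D₀.mark 1 = t₁ := rfl
  have hm2 : D₀.mark 2 = u := rfl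
  have hm3 : D₀.mark 3 = v := rfl
  have hn0 : D₀.nextMark 0 = t₁ := by rw [D₀.nextMark_of_lt 0 (by decide)]; rfl
  have hn2 : D₀.nextMark 2 = v := by rw [D₀.nextMark_of_lt 2 (by decide)]; rfl
  have harc0 : D₀.arc 0 = D₀.boundary '' Icc 0 t₁ := by rw [MarkedDomain.arc, hm0, hn0]
  have harc2 : D₀.arc 2 = D₀.boundary '' Icc u v := by rw [MarkedDomain.arc, hm2, hn2]
  have hfront : frontier D₀.carrier = D₀.boundary '' Ico 0 1 := D₀.frontier_eq_image_Ico
  have hfr : ∀ {t : ℝ}, t ∈ Ico (0 : ℝ) 1 → Ψ t ∈ frontier (symRect a b) := fun ht =>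
    RectLoop.mem_frontier_of_mem hΨr ht
  set R' : ConformalRectangle := MarkedDomain.image D₀ gr hgrc' hgri' with hR'
  refine ⟨R', ?_, ?_, ?_, ?_, ?_, ?_, ?_⟩
  · -- tame
    exact htame
  · -- closure inside `F(Q)`
    rw [MarkedDomain.closure_carrier_image, hcl]
    rintro _ ⟨z, hz, rfl⟩
    exact hsub z hz
  · -- the deep part is inside
    intro p hpre hpim
    exact hdeep p hpre hpim
  · -- arc 0
    intro z hz
    rw [MarkedDomain.arc_image, harc0] at hz
    obtain ⟨_, ⟨t, ht, rfl⟩, rfl⟩ := hz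
    exact ⟨Ψ t, hfr ⟨ht.1, ht.2.trans_lt ht₁.2⟩, P1 t ht, hbd t ▸ hclose t⟩
  · -- arc 2
    intro z hz
    rw [MarkedDomain.arc_image, harc2] at hz
    obtain ⟨_, ⟨t, ht, rfl⟩, rfl⟩ := hz
    exact ⟨Ψ t, hfr ⟨hu0.le.trans ht.1, ht.2.trans_lt hv⟩, P3 t ht, hbd t ▸ hclose t⟩
  · -- frontier versus arc 0
    intro z hz
    rw [MarkedDomain.frontier_carrier_image, hfront] at hz
    obtain ⟨_, ⟨t, ht, rfl⟩, rfl⟩ := hz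
    by_cases hle : t ≤ t₁
    · left
      rw [MarkedDomain.arc_image, harc0]
      exact mem_image_of_mem _ (mem_image_of_mem _ ⟨ht.1, hle⟩)
    · right
      exact ⟨Ψ t, hfr ht, P2 t ⟨(lt_of_not_ge hle).le, ht.2.le⟩, hbd t ▸ hclose t⟩
  · -- frontier versus arc 2
    intro z hz
    rw [MarkedDomain.frontier_carrier_image, hfront] at hz
    obtain ⟨_, ⟨t, ht, rfl⟩, rfl⟩ := hz
    by_cases hmem : t ∈ Icc u v
    · left
      rw [MarkedDomain.arc_image, harc2]
      exact mem_image_of_mem _ (mem_image_of_mem _ hmem)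
    · right
      refine ⟨Ψ t, hfr ht, ?_, hbd t ▸ hclose t⟩
      rcases lt_or_ge t u with hlt | hge
      · exact P4 t ⟨ht.1, hlt.le⟩
      · have hvt : v < t := lt_of_not_ge fun hle => hmem ⟨hge, hle⟩
        exact P5 t ⟨hvt.le, ht.2.le⟩

/-- **Tame level rectangles in a chart** (Schramm–Smirnov's perturbed quads, smoothed by Riemann-map
level curves). Let `F` be a homeomorphism of the plane, `Q = (-a, a) × (-b, b)`, `0 < h < b` and
`η > 0`. There is a conformal rectangle `R'` with `C²`-regular boundary loop (a level curve
`g(|z| = r)` of a Riemann map `g : 𝔻 → F(Q)`, marked at the boundary-correspondence preimages of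
the four lateral points `F(∓a, ∓h)`), such that: `closure R' ⊆ F(Q)`; `F` maps the points of `Q`
that are `η`-deep (in each coordinate) into `R'`; every point of `R'.arc 0` (`R'.arc 2`) is, read
through `F⁻¹`, within `η` of a point of `∂Q` of height `≤ -h` (`≥ h`); and every frontier point of
`R'` off `R'.arc 0` (off `R'.arc 2`) is within `η` of a point of `∂Q` of height `≥ -h` (`≤ h`).
Ingredients: Riemann mapping theorem (`exists_conformalEquiv_ball_holds`), Carathéodory's theorem
(`JordanDomain.exists_continuousOn_extension_holds`), uniform continuity on the closed disc.
[cite: SchrammSmirnov2011, §5 (proof of Lemma 5.1)] -/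
theorem exists_tame_levelRectangle (F : ℂ ≃ₜ ℂ) {a b h η : ℝ} (ha : 0 < a) (hh : 0 < h)
    (hhb : h < b) (hη : 0 < η) :
    ∃ R' : ConformalRectangle,
      (ContDiff ℝ 2 R'.boundary ∧ ∀ t : ℝ, deriv R'.boundary t ≠ 0) ∧
      closure R'.carrier ⊆ F '' symRect a b ∧
      (∀ p : ℂ, |p.re| ≤ a - η → |p.im| ≤ b - η → F p ∈ R'.carrier) ∧
      (∀ z ∈ R'.arc 0, ∃ q ∈ frontier (symRect a b), q.im ≤ -h ∧ dist (F.symm z) q < η) ∧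
      (∀ z ∈ R'.arc 2, ∃ q ∈ frontier (symRect a b), h ≤ q.im ∧ dist (F.symm z) q < η) ∧
      (∀ z ∈ frontier R'.carrier,
        z ∈ R'.arc 0 ∨ ∃ q ∈ frontier (symRect a b), -h ≤ q.im ∧ dist (F.symm z) q < η) ∧
      (∀ z ∈ frontier R'.carrier,
        z ∈ R'.arc 2 ∨ ∃ q ∈ frontier (symRect a b), q.im ≤ h ∧ dist (F.symm z) q < η) := by
  have hb : 0 < b := hh.trans hhb
  -- the Jordan domain `G = F(Q)`, a Riemann map `g : 𝔻 → G` and its Carathéodory extension `Φ`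
  set G : JordanDomain := (rectDomain a b ha hb).map F with hG
  have hGc : G.carrier = F '' symRect a b := rfl
  have hfrG : frontier G.carrier = F '' frontier (symRect a b) := by
    rw [hGc, ← F.image_frontier]
  obtain ⟨ψ⟩ := exists_conformalEquiv_ball_holds G.isOpen G.isSimplyConnected_holds G.carrier_ne_univ
  set g := ψ.symm with hg
  obtain ⟨Φ, hΦc, hΦg, hΦbij, hΦsph⟩ := JordanDomain.exists_continuousOn_extension_holds G g
  -- uniform continuity of the extension read in the chart
  have hΘc : ContinuousOn (fun z => F.symm (Φ z)) (closedBall (0 : ℂ) 1) :=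
    F.symm.continuous.comp_continuousOn hΦc
  obtain ⟨δ, hδ, hδu⟩ := Metric.uniformContinuousOn_iff.1
    ((isCompact_closedBall (0 : ℂ) 1).uniformContinuousOn_of_continuous hΘc) η hη
  -- the level `r`
  set r : ℝ := max (1 / 2) (1 - δ / 2) with hr
  have hr0 : 0 < r := lt_max_of_lt_left one_half_pos
  have hr1 : r < 1 := max_lt one_half_lt_one (by linarith)
  have hrδ : 1 - r < δ := by have := le_max_right (1 / 2) (1 - δ / 2); linarith
  -- chart partners of the points of the annulus `r ≤ |z| ≤ 1`
  have partner : ∀ z ∈ closedBall (0 : ℂ) 1, r ≤ ‖z‖ →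
      ∃ q ∈ frontier (symRect a b), dist (F.symm (Φ z)) q < η := by
    intro z hz hrz
    have hn : 0 < ‖z‖ := hr0.trans_le hrz
    have hz1 : ‖z‖ ≤ 1 := mem_closedBall_zero_iff.1 hz
    set w : ℂ := (‖z‖⁻¹ : ℝ) • z with hw
    have hw1 : ‖w‖ = 1 := norm_smul_inv_norm (norm_pos_iff.1 hn)
    have hws : w ∈ sphere (0 : ℂ) 1 := mem_sphere_zero_iff_norm.2 hw1
    have hle : 1 - ‖z‖⁻¹ ≤ 0 := by rw [sub_nonpos]; exact (one_le_inv₀ hn).2 hz1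
    have e : dist z w = 1 - ‖z‖ := by
      rw [dist_eq_norm, hw, show z - (‖z‖⁻¹ : ℝ) • z = ((1 - ‖z‖⁻¹ : ℝ)) • z by
        rw [sub_smul, one_smul], norm_smul, Real.norm_eq_abs, abs_of_nonpos hle, neg_sub, sub_mul,
        inv_mul_cancel₀ hn.ne', one_mul]
    have hdist : dist z w < δ := by rw [e]; linarith
    refine ⟨F.symm (Φ w), ?_, hδu z hz w (sphere_subset_closedBall hws) hdist⟩
    obtain ⟨q, hq, hqw⟩ : Φ w ∈ F '' frontier (symRect a b) := hfrG ▸ hΦsph.mapsTo hws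
    rw [← hqw, Homeomorph.symm_apply_apply]
    exact hq
  -- the embedding of the closed disc `z ↦ g (r z)`
  set gr : ℂ → ℂ := fun z => Φ ((r : ℂ) * z) with hgr
  have hrz : ∀ z ∈ closedBall (0 : ℂ) 1, (r : ℂ) * z ∈ ball (0 : ℂ) 1 := fun z hz => by
    rw [mem_ball_zero_iff, norm_mul, Complex.norm_real, Real.norm_eq_abs, abs_of_pos hr0]
    have := mem_closedBall_zero_iff.1 hz
    nlinarith
  have hgrc : ContinuousOn gr (closedBall 0 1) :=
    hΦc.comp (continuous_const.mul continuous_id).continuousOn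
      fun z hz => ball_subset_closedBall (hrz z hz)
  have hgri : InjOn gr (closedBall 0 1) := fun z₁ h₁ z₂ h₂ e =>
    mul_left_cancel₀ (Complex.ofReal_ne_zero.2 hr0.ne')
      (hΦbij.injOn (ball_subset_closedBall (hrz z₁ h₁)) (ball_subset_closedBall (hrz z₂ h₂)) e)
  have hgr_eq : ∀ z ∈ closedBall (0 : ℂ) 1, gr z = g ((r : ℂ) * z) := fun z hz => hΦg (hrz z hz)
  have hcm : ∀ s : ℝ, (r : ℂ) * circleMap 0 1 s = circleMap 0 r s := fun s => by simp [circleMap]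
  have hcm1 : ∀ s : ℝ, circleMap 0 1 s ∈ closedBall (0 : ℂ) 1 := fun s => by
    rw [mem_closedBall_zero_iff, norm_circleMap_zero, abs_one]
  have htame : ∀ θ : ℝ, ContDiff ℝ 2 (fun t : ℝ => gr (circleMap 0 1 (2 * π * t + θ))) ∧
      ∀ t : ℝ, deriv (fun t : ℝ => gr (circleMap 0 1 (2 * π * t + θ))) t ≠ 0 := by
    intro θ
    have e : (fun t : ℝ => gr (circleMap 0 1 (2 * π * t + θ))) =
        fun t : ℝ => g (circleMap 0 r (2 * π * t + θ)) := by
      funext t; rw [hgr_eq _ (hcm1 _), hcm]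
    rw [e]
    exact contDiff_levelLoop g hr0 hr1 θ
  have hsub : ∀ z ∈ closedBall (0 : ℂ) 1, gr z ∈ F '' symRect a b := fun z hz => by
    rw [hgr_eq z hz]; exact g.mapsTo (hrz z hz)
  have hdeep : ∀ p : ℂ, |p.re| ≤ a - η → |p.im| ≤ b - η → F p ∈ gr '' ball 0 1 := by
    intro p hpre hpim
    rw [abs_le] at hpre hpim
    have hp : p ∈ symRect a b := by
      rw [mem_symRect]; refine ⟨⟨?_, ?_⟩, ?_, ?_⟩ <;> linarith
    obtain ⟨w, hw, hgw⟩ := g.bijOn.surjOn (show F p ∈ G.carrier from mem_image_of_mem F hp)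
    by_cases hwr : ‖w‖ < r
    · refine ⟨(r : ℂ)⁻¹ * w, ?_, ?_⟩
      · rw [mem_ball_zero_iff, norm_mul, norm_inv, Complex.norm_real, Real.norm_eq_abs,
          abs_of_pos hr0, inv_mul_lt_iff₀ hr0, mul_one]
        exact hwr
      · show Φ ((r : ℂ) * ((r : ℂ)⁻¹ * w)) = F p
        rw [mul_inv_cancel_left₀ (Complex.ofReal_ne_zero.2 hr0.ne'), hΦg hw, hgw]
    · exfalso
      obtain ⟨q, hq, hdq⟩ := partner w (ball_subset_closedBall hw) (le_of_not_gt hwr)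
      rw [hΦg hw, hgw, Homeomorph.symm_apply_apply, dist_eq_norm] at hdq
      have hre := Complex.abs_re_le_norm (p - q)
      have him := Complex.abs_im_le_norm (p - q)
      rw [Complex.sub_re] at hre
      rw [Complex.sub_im] at him
      rcases (mem_frontier_symRect ha hb).1 hq with ⟨-, hqi | hqi⟩ | ⟨hqr | hqr, -⟩
      · have : η ≤ |p.im - q.im| := by rw [hqi, le_abs]; left; linarith
        linarith
      · have : η ≤ |p.im - q.im| := by rw [hqi, le_abs]; right; linarith
        linarith
      · have : η ≤ |p.re - q.re| := by rw [hqr, le_abs]; left; linarith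
        linarith
      · have : η ≤ |p.re - q.re| := by rw [hqr, le_abs]; right; linarith
        linarith
  -- the two lower lateral points and the phase of the first one
  have hP₀ : (⟨-a, -h⟩ : ℂ) ∈ frontier (symRect a b) :=
    (mem_frontier_symRect ha hb).2 (Or.inr ⟨Or.inl rfl, by simp; constructor <;> linarith⟩)
  have hP₁ : (⟨a, -h⟩ : ℂ) ∈ frontier (symRect a b) :=
    (mem_frontier_symRect ha hb).2 (Or.inr ⟨Or.inr rfl, by simp; constructor <;> linarith⟩)
  obtain ⟨ζ₀, hζ₀s, hζ₀⟩ :=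
    hΦsph.surjOn (show F ⟨-a, -h⟩ ∈ frontier G.carrier from hfrG ▸ mem_image_of_mem F hP₀)
  set θ₀ : ℝ := Complex.arg ζ₀ with hθ₀
  have hζ₀1 : ‖ζ₀‖ = 1 := mem_sphere_zero_iff_norm.1 hζ₀s
  have hcirc0 : circleMap 0 1 θ₀ = ζ₀ := by
    have := Complex.norm_mul_exp_arg_mul_I ζ₀
    rw [hζ₀1, Complex.ofReal_one, one_mul] at this
    simpa [circleMap, hθ₀] using this
  -- the boundary correspondence read in the chart, from any phase
  have hloop : ∀ θ : ℝ,
      Continuous (fun t : ℝ => F.symm (Φ (circleMap 0 1 (2 * π * t + θ)))) ∧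
      (fun t : ℝ => F.symm (Φ (circleMap 0 1 (2 * π * t + θ)))) 1 =
        (fun t : ℝ => F.symm (Φ (circleMap 0 1 (2 * π * t + θ)))) 0 ∧
      InjOn (fun t : ℝ => F.symm (Φ (circleMap 0 1 (2 * π * t + θ)))) (Ico 0 1) ∧
      (fun t : ℝ => F.symm (Φ (circleMap 0 1 (2 * π * t + θ)))) '' Ico 0 1 =
        frontier (symRect a b) ∧
      ∀ t : ℝ, dist (F.symm (gr (circleMap 0 1 (2 * π * t + θ))))
        ((fun t : ℝ => F.symm (Φ (circleMap 0 1 (2 * π * t + θ)))) t) < η := by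
    intro θ
    set D : JordanDomain := JordanDomain.rotUnitDisc θ with hD
    have hbd : ∀ t, D.boundary t = circleMap 0 1 (2 * π * t + θ) := fun t => rfl
    have hsph : ∀ t, D.boundary t ∈ sphere (0 : ℂ) 1 := fun t => by
      rw [hbd, mem_sphere_zero_iff_norm, norm_circleMap_zero, abs_one]
    refine ⟨?_, ?_, ?_, ?_, ?_⟩
    · exact hΘc.comp_continuous D.continuous_boundary fun t => sphere_subset_closedBall (hsph t)
    · show F.symm (Φ (D.boundary 1)) = F.symm (Φ (D.boundary 0))
      have := D.periodic_boundary 0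
      rw [zero_add] at this
      rw [this]
    · intro s hs t ht e
      exact D.injOn_boundary hs ht (hΦsph.injOn (hsph s) (hsph t) (F.symm.injective e))
    · show (fun t => F.symm (Φ (D.boundary t))) '' Ico 0 1 = _
      rw [← image_image (fun z => F.symm (Φ z)) D.boundary, ← D.frontier_eq_image_Ico,
        show D.carrier = ball 0 1 from rfl, frontier_ball (0 : ℂ) one_ne_zero,
        ← image_image F.symm Φ, hΦsph.image_eq, hfrG, image_image]
      simp only [Homeomorph.symm_apply_apply, image_id']
    · intro t
      show dist (F.symm (Φ ((r : ℂ) * D.boundary t))) (F.symm (Φ (D.boundary t))) < η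
      refine hδu _ (ball_subset_closedBall (hrz _ (sphere_subset_closedBall (hsph t)))) _
        (sphere_subset_closedBall (hsph t)) ?_
      rw [dist_eq_norm, show (r : ℂ) * D.boundary t - D.boundary t = ((r - 1 : ℝ) : ℂ) * D.boundary t by
        push_cast; ring, norm_mul, Complex.norm_real, mem_sphere_zero_iff_norm.1 (hsph t), mul_one,
        Real.norm_eq_abs, abs_sub_comm, abs_of_pos (by linarith)]
      exact hrδ
  -- the loop from the phase of `ζ₀` starts at `(-a, -h)`
  obtain ⟨hc0, h10, hi0, hr0', hcl0⟩ := hloop θ₀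
  set Ψ₀ : ℝ → ℂ := fun t : ℝ => F.symm (Φ (circleMap 0 1 (2 * π * t + θ₀))) with hΨ₀
  have hΨ₀0 : Ψ₀ 0 = ⟨-a, -h⟩ := by
    simp only [hΨ₀]
    rw [mul_zero, zero_add, hcirc0, hζ₀, Homeomorph.symm_apply_apply]
  have h0 : (Ψ₀ 0).im = -h := by rw [hΨ₀0]
  obtain ⟨t₁, ht₁, e₁⟩ := RectLoop.exists_param hr0' hP₁
  have h1 : (Ψ₀ t₁).im = -h := by rw [e₁]
  have ht₁0 : t₁ ≠ 0 := by
    rintro rfl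
    have := congrArg Complex.re (hΨ₀0.symm.trans e₁)
    simp at this
    linarith
  have ht₁' : t₁ ∈ Ioo (0 : ℝ) 1 := ⟨lt_of_le_of_ne ht₁.1 (Ne.symm ht₁0), ht₁.2⟩
  rcases RectLoop.forall_Ioo_im_lt_or ha hh hhb hc0 hi0 hr0' h0 ht₁' h1 with hor | hor
  · exact exists_levelRectangle_of_data F ha hh hhb hgrc hgri (htame θ₀) hc0 h10 hi0 hr0' h0 ht₁'
      h1 hor hcl0 hsub hdeep
  · -- opposite orientation: start the loop at the other lower lateral point
    set θ₁ : ℝ := θ₀ + 2 * π * t₁ with hθ₁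
    obtain ⟨hc1, h11, hi1, hr1', hcl1⟩ := hloop θ₁
    have hshift : ∀ t : ℝ,
        (fun t : ℝ => F.symm (Φ (circleMap 0 1 (2 * π * t + θ₁)))) t = Ψ₀ (t + t₁) := by
      intro t
      simp only [hΨ₀, hθ₁]
      rw [show 2 * π * t + (θ₀ + 2 * π * t₁) = 2 * π * (t + t₁) + θ₀ by ring]
    have h0' : ((fun t : ℝ => F.symm (Φ (circleMap 0 1 (2 * π * t + θ₁)))) 0).im = -h := by
      rw [hshift, zero_add, h1]
    have h1' : ((fun t : ℝ => F.symm (Φ (circleMap 0 1 (2 * π * t + θ₁)))) (1 - t₁)).im = -h := by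
      rw [hshift, sub_add_cancel, show Ψ₀ 1 = Ψ₀ 0 from h10, h0]
    have ht₁'' : 1 - t₁ ∈ Ioo (0 : ℝ) 1 := ⟨by linarith [ht₁'.2], by linarith [ht₁'.1]⟩
    have hor' : ∀ t ∈ Ioo 0 (1 - t₁),
        ((fun t : ℝ => F.symm (Φ (circleMap 0 1 (2 * π * t + θ₁)))) t).im < -h := fun t ht => by
      rw [hshift]
      exact hor (t + t₁) ⟨by linarith [ht.1], by linarith [ht.2]⟩
    exact exists_levelRectangle_of_data F ha hh hhb hgrc hgri (htame θ₁) hc1 h11 hi1 hr1' h0' ht₁''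
      h1' hor' hcl1 hsub hdeep

end Literature.Probability.RandomPlanarGeometry

end
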